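import Mathlib

/-!
# `Balaban1983to89.B11LocalMin150` — [Balaban1985Variational] Sect. F, p. 301: «hence it is a minimum of this functional
in the space (150)» — the transfer of (local) minimality from the space (6) to the local space (150), CERTIFIED
(cell GAPS G-B11-F5 → C-B11-F5a)

CITATION HEADER (lean-in-tree rule 2026-08-18).  Source: T. Bałaban, *The variational problem and background fields in
renormalization group method for lattice gauge theories*, Commun. Math. Phys. **102**, 277–309 (1985),
doi:10.1007/bf01229381 (cell paper B11; held `paper:balaban1985-cmp102-variational-background`; journal page = PDF page
+ 276; quotations from the page renders pp. 300–302 [PDF 24–26]).  Reference of the paper used: [6] =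
[Balaban1985RegularSpaces], Sect. F p. 98 [PDF 24] (the sequence of cubes; render
`1985-cmp99-regular-spaces-gauge-fixing-p024`).  Mathlib-only; modifies nothing in `…B11`, `…B11Thm1`, `…B11SectG`,
`…B11GlobalMin`.  Cell record: `HOME/b2b-balaban-b11/LOCAL-MIN-150.md`.

THE PRINTED STEP.  p. 300: *"In this section we will prove all the regularity properties of minimal configurations U_k.
We will use only the fact that they are critical configurations of the functional (5) and that they belong to the
spaces (6) with ε₀ sufficiently small."*  p. 301, after (148)–(150) (ℭ_k = ⋃_{j=0}^k Λ′_j, Λ′_0 = □₁^c ∩ □̃, …;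
V″ = Ū′_k^j on Λ′_j; *"U′_k ∈ 𝔘_k({Ω′_j}, ε₀) ∩ 𝔅_k(ℭ_k, V″) ∩ Ax_k(ℭ_k, 1), (150) where Ω′_j = □_j, j = 0, 1, …, k − 1,
Ω′_k = □″_k"*): *"The configuration U′_k is a minimum of the functional (5) in the space (6) with V′ instead of V, hence
it is a minimum of this functional in the space (150), because this space is defined by more restrictive functional
conditions and a sufficiently small neighborhood of U′_k in (150) is contained in (6)."*  Consumed on p. 302: *"Of
course we can apply these transformations to all configurations in the space (150) and we get an open set of
configurations A′ … The image of U′_k is a minimum of 𝔉(A′), thus representing it as A₁ + HB, we obtain Eq. (143) for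
A₁"* — i.e. only as: U′_k is a LOCAL minimum (hence a critical point) of the action over (150).

WHAT THIS MODULE CERTIFIES (topology only; the lattice content is in the record LOCAL-MIN-150.md §2): the sentence is an
instance of three elementary facts — (i) `isLocalMinOn_transfer`: if U is a local (a fortiori a global,
`isLocalMinOn_transfer_of_isMinOn`) minimum of 𝓐 on S₆ and some neighbourhood N of U has S₁₅₀ ∩ N ⊆ S₆
(`NearContained`, verbatim "a sufficiently small neighborhood of U′_k in (150) is contained in (6)"), then U is a local
minimum of 𝓐 on S₁₅₀ — membership U ∈ S₁₅₀ is not even needed for the filter statement; (ii) `isLocalMinOn_pullback`: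
local minimality pulls back along the (continuous, constraint-respecting) extension map E : (configurations on □̃) →
(configurations on T), E(U) = U inside □̃ and = U′_k outside, so that the localisation to the cube □̃ of [6] Sect. F is
harmless; (iii) `isLocalMinOn_of_add_const`: on (150) the full action and the action restricted to □̃ («the functional
𝔉(A′)») differ by the constant Σ_{p ⊄ □̃} [1 − Re tr U′_k(∂p)] (U = U′_k on the collar Λ′_0 = □̃ ∖ □₁, of width ≥ R₁M₁η),
and adding a constant preserves local minimality.  Why the two set-theoretic hypotheses hold on the lattice
("more restrictive functional conditions": finer averages prescribed on □_j ∖ □_{j+1} determine the coarser ones by the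
iterative definition of the j-fold average and the block alignment *"for every j the cube □_j is a sum of the big blocks
of the lattice"* of [6] p. 98; "neighborhood … contained": the bounds (2) are finitely many STRICT inequalities, so they
persist near U′_k although (150) imposes them with the weaker local scale assignment Ω′_j = □_j) is spelled out in the
record; no estimate of the paper is involved.  The local/global reading of «minimum» (cell DIVERGENCE D-B11-2) is
immaterial here: both readings transfer, and p. 302 consumes only criticality.

Scope: restates no theorem of the series; value = certification of one sentence (typed bookkeeping), NOT summit
progress.
-/

namespace Literature.MathematicalPhysics.QuantumFieldTheory.Balaban1983to89.B11LocalMin150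

open Filter Topology Set

section Transfer

variable {X : Type*} [TopologicalSpace X]

/-- p. 301, verbatim *"a sufficiently small neighborhood of U′_k in (150) is contained in (6)"*: some neighbourhood N
of U has S₁₅₀ ∩ N ⊆ S₆. [cite: Balaban1985Variational, p.301 after (150)] -/
def NearContained (S150 S6 : Set X) (U : X) : Prop :=
  ∃ N ∈ 𝓝 U, S150 ∩ N ⊆ S6

/-- If S₁₅₀ ⊆ S₆ outright ("more restrictive functional conditions" alone) the containment holds with N = univ.
[folklore] -/
theorem nearContained_of_subset {S150 S6 : Set X} {U : X} (h : S150 ⊆ S6) : NearContained S150 S6 U :=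
  ⟨univ, univ_mem, by simpa using h⟩

/-- The printed situation: S₁₅₀ = C ∩ O′ (constraints ∩ the weaker open small-field conditions of 𝔘_k({Ω′_j}, ε₀)),
S₆ ⊇ C ∩ O with O an OPEN set containing U (the strict inequalities (2) at the original scale assignment, satisfied by
U′_k): then N = O works. [cite: Balaban1985Variational, (2) p.278, (150) p.301] -/
theorem nearContained_of_open {C O O' S6 : Set X} {U : X} (hO : IsOpen O) (hU : U ∈ O) (hsub : C ∩ O ⊆ S6) :
    NearContained (C ∩ O') S6 U :=
  ⟨O, hO.mem_nhds hU, fun _ hx => hsub ⟨hx.1.1, hx.2⟩⟩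

/-- The filter comparison behind the sentence: 𝓝[S₁₅₀] U ≤ 𝓝[S₆] U. [folklore] -/
theorem nhdsWithin_le_of_nearContained {S150 S6 : Set X} {U : X} (h : NearContained S150 S6 U) :
    𝓝[S150] U ≤ 𝓝[S6] U := by
  obtain ⟨N, hN, hsub⟩ := h
  rw [nhdsWithin_restrict' S150 hN]
  exact nhdsWithin_mono U hsub

/-- **p. 301, the transfer (local reading).**  A local minimum of 𝓐 on (6) is a local minimum of 𝓐 on (150) as soon as
a neighbourhood of it in (150) is contained in (6). [cite: Balaban1985Variational, p.301 after (150)] -/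
theorem isLocalMinOn_transfer {𝓐 : X → ℝ} {S150 S6 : Set X} {U : X} (hmin : IsLocalMinOn 𝓐 S6 U)
    (h : NearContained S150 S6 U) : IsLocalMinOn 𝓐 S150 U :=
  hmin.filter_mono (nhdsWithin_le_of_nearContained h)

/-- **p. 301, the transfer (global reading of «minimum … in the space (6)»).**  [cite: Balaban1985Variational, p.301] -/
theorem isLocalMinOn_transfer_of_isMinOn {𝓐 : X → ℝ} {S150 S6 : Set X} {U : X} (hmin : IsMinOn 𝓐 S6 U)
    (h : NearContained S150 S6 U) : IsLocalMinOn 𝓐 S150 U :=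
  isLocalMinOn_transfer hmin.localize h

omit [TopologicalSpace X] in
/-- If moreover S₁₅₀ ⊆ S₆ outright, a GLOBAL minimum on (6) is a global minimum on (150). [folklore] -/
theorem isMinOn_transfer_of_subset {𝓐 : X → ℝ} {S150 S6 : Set X} {U : X} (hmin : IsMinOn 𝓐 S6 U)
    (h : S150 ⊆ S6) : IsMinOn 𝓐 S150 U :=
  hmin.on_subset h

end Transfer

section Localisation

variable {X Y : Type*} [TopologicalSpace X] [TopologicalSpace Y]

/-- **Localisation to the cube □̃** ([6] Sect. F p. 98; B11 p. 301 Λ′_0 = □₁^c ∩ □̃: on the collar □̃ ∖ □₁ the 0-th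
"average" — the configuration itself — is prescribed, U = U′_k).  Abstractly: E : Y → X the extension of a
configuration on □̃ by U′_k outside, continuous within T at y₀ and mapping the local constraint set T into S₁₅₀;
a local minimum of 𝓐 on S₁₅₀ at E y₀ pulls back to a local minimum of 𝓐 ∘ E on T at y₀. [folklore]
[cite: Balaban1985RegularSpaces, Sect. F p.98] -/
theorem isLocalMinOn_pullback {𝓐 : X → ℝ} {S150 : Set X} {T : Set Y} {E : Y → X} {y₀ : Y}
    (hmin : IsLocalMinOn 𝓐 S150 (E y₀)) (hE : ContinuousWithinAt E T y₀) (hmaps : MapsTo E T S150) :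
    IsLocalMinOn (𝓐 ∘ E) T y₀ :=
  hmin.comp_tendsto (hE.tendsto_nhdsWithin hmaps)

/-- **The functional 𝔉 on □̃ vs the full action (5).**  If on T the pulled-back action differs from the local
functional 𝓕 by a constant c (the plaquettes not inside □̃ see only U′_k, because U = U′_k on the collar of width
≥ R₁M₁η ≥ one lattice spacing), local minimality passes to 𝓕. [folklore] [cite: Balaban1985Variational, (5) p.278, p.302] -/
theorem isLocalMinOn_of_add_const {𝓖 𝓕 : Y → ℝ} {T : Set Y} {y₀ : Y} {c : ℝ} (hmin : IsLocalMinOn 𝓖 T y₀)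
    (heq : ∀ y ∈ T, 𝓖 y = 𝓕 y + c) (hy₀ : y₀ ∈ T) : IsLocalMinOn 𝓕 T y₀ := by
  have h1 : ∀ᶠ y in 𝓝[T] y₀, 𝓖 y₀ ≤ 𝓖 y := hmin
  have h2 : ∀ᶠ y in 𝓝[T] y₀, y ∈ T := eventually_mem_nhdsWithin
  show ∀ᶠ y in 𝓝[T] y₀, 𝓕 y₀ ≤ 𝓕 y
  filter_upwards [h1, h2] with y hy hyT
  rw [heq y₀ hy₀, heq y hyT] at hy
  linarith

/-- **The sentence of p. 301 as consumed on p. 302**, assembled: from a local minimum of the action on (6) (with V′),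
the near-containment of (150) in (6), the extension map of the cube □̃ and the constant difference of the functionals,
U′_k|□̃ is a local minimum of 𝔉 on the local space — hence a critical configuration, which is all Sect. F uses
(p. 300). [cite: Balaban1985Variational, pp.300–302] -/
theorem localMin150 {𝓐 : X → ℝ} {𝓕 : Y → ℝ} {S6 S150 : Set X} {T : Set Y} {E : Y → X} {y₀ : Y} {c : ℝ}
    (hmin : IsLocalMinOn 𝓐 S6 (E y₀)) (hnear : NearContained S150 S6 (E y₀))
    (hE : ContinuousWithinAt E T y₀) (hmaps : MapsTo E T S150) (hy₀ : y₀ ∈ T)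
    (heq : ∀ y ∈ T, 𝓐 (E y) = 𝓕 y + c) : IsLocalMinOn 𝓕 T y₀ :=
  isLocalMinOn_of_add_const (isLocalMinOn_pullback (isLocalMinOn_transfer hmin hnear) hE hmaps)
    (fun y hy => heq y hy) hy₀

end Localisation

end Literature.MathematicalPhysics.QuantumFieldTheory.Balaban1983to89.B11LocalMin150
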